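import Mathlib

/-!
# Coefficients of an affine substitution `R(l + t·X)` in two variables

Helper file for item stmt-Schanuel-0975 (`TwoLogsBranchRelationFinite`, route RigidCore):
the top-degree and next-to-top-degree coefficients of `R(l₀ + s X₀, l₁ + s X₁)`.
-/

noncomputable section

-- `Summit.Schanuel.Schanuel` is the tree's mandated `Summit.<Summit>.<Problem>` prefix (single-problem summit).
set_option linter.dupNamespace false

open MvPolynomial Finset

namespace Summit.Schanuel.Schanuel.Theorems.RigidCore.TwoLogs

variable {L : Type*} [Field L]

/-- Two finitely supported functions on `Fin 2` agree iff they agree at `0` and `1`. -/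
theorem finsupp_fin_two_eq_iff (m n : Fin 2 →₀ ℕ) : m = n ↔ m 0 = n 0 ∧ m 1 = n 1 := by
  constructor
  · rintro rfl; exact ⟨rfl, rfl⟩
  · rintro ⟨h0, h1⟩
    ext i
    fin_cases i
    · exact h0
    · exact h1

/-- The degree `|m| = m 0 + m 1` of an exponent vector on `Fin 2`. -/
theorem degree_fin_two (m : Fin 2 →₀ ℕ) : (m.sum fun _ e => e) = m 0 + m 1 := by
  rw [Finsupp.sum_fintype _ _ (fun _ => rfl)]
  exact Fin.sum_univ_two _

/-- Binomial expansion of a power of a linear form in one variable, as a sum of monomials. -/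
theorem linear_pow_eq_sum (a s : L) (i : Fin 2) (k : ℕ) :
    (C a + C s * X i : MvPolynomial (Fin 2) L) ^ k =
      ∑ j ∈ range (k + 1), monomial (Finsupp.single i j) (s ^ j * a ^ (k - j) * (k.choose j : L)) := by
  rw [add_comm, add_pow]
  refine Finset.sum_congr rfl (fun j _ => ?_)
  rw [C_mul_X_eq_monomial, monomial_pow, Finsupp.smul_single, smul_eq_mul, mul_one, ← C_pow,
    ← C_eq_coe_nat, mul_assoc, ← C_mul, mul_comm, C_mul_monomial]
  congr 1
  ring

/-- Coefficients of the product of powers of the two linear forms `l i + s X i`. -/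
theorem coeff_linear_pow_mul (l : Fin 2 → L) (s : L) (m n : Fin 2 →₀ ℕ) :
    coeff n ((C (l 0) + C s * X 0) ^ (m 0) * (C (l 1) + C s * X 1) ^ (m 1) :
      MvPolynomial (Fin 2) L) =
      if n 0 ≤ m 0 ∧ n 1 ≤ m 1 then
        (s ^ (n 0) * l 0 ^ (m 0 - n 0) * ((m 0).choose (n 0) : L)) *
        (s ^ (n 1) * l 1 ^ (m 1 - n 1) * ((m 1).choose (n 1) : L))
      else 0 := by
  classical
  rw [linear_pow_eq_sum, linear_pow_eq_sum, Finset.sum_mul_sum]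
  simp_rw [monomial_mul, coeff_sum, coeff_monomial]
  have key : ∀ j₀ j₁ : ℕ, (Finsupp.single (0 : Fin 2) j₀ + Finsupp.single (1 : Fin 2) j₁ = n) ↔
      (j₁ = n 1 ∧ j₀ = n 0) := by
    intro j₀ j₁
    rw [finsupp_fin_two_eq_iff]
    simp only [Finsupp.coe_add, Pi.add_apply, Finsupp.single_apply]
    simp only [Fin.one_eq_zero_iff, OfNat.ofNat_ne_one, ↓reduceIte, add_zero, Fin.zero_eq_one_iff,
      zero_add]
    tauto
  simp_rw [key, ite_and, Finset.sum_ite_eq', Finset.mem_range, Nat.lt_succ_iff]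
  by_cases h1 : n 1 ≤ m 1 <;> by_cases h0 : n 0 ≤ m 0 <;> simp [h0, h1]

/-- Coefficient expansion of the affine substitution `X i ↦ l i + s X i`. -/
theorem coeff_aeval_affine (l : Fin 2 → L) (s : L) (Q : MvPolynomial (Fin 2) L) (n : Fin 2 →₀ ℕ) :
    coeff n (aeval (fun i => C (l i) + C s * X i) Q) =
      ∑ m ∈ Q.support, coeff m Q *
        coeff n ((C (l 0) + C s * X 0) ^ (m 0) * (C (l 1) + C s * X 1) ^ (m 1) :
          MvPolynomial (Fin 2) L) := by
  conv_lhs => rw [Q.as_sum]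
  rw [map_sum, coeff_sum]
  refine Finset.sum_congr rfl (fun m _ => ?_)
  rw [aeval_monomial, algebraMap_eq, coeff_C_mul, Finsupp.prod_fintype _ _ (fun i => pow_zero _),
    Fin.prod_univ_two]

/-- The affine substitution does not raise the total degree: a nonzero coefficient at `n`
forces `|n| ≤ deg Q`. -/
theorem degree_le_of_coeff_aeval_affine_ne_zero (l : Fin 2 → L) (s : L) (Q : MvPolynomial (Fin 2) L)
    (n : Fin 2 →₀ ℕ) (h : coeff n (aeval (fun i => C (l i) + C s * X i) Q) ≠ 0) :
    n 0 + n 1 ≤ Q.totalDegree := by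
  rw [coeff_aeval_affine] at h
  obtain ⟨m, hm, hne⟩ := Finset.exists_ne_zero_of_sum_ne_zero h
  rw [coeff_linear_pow_mul] at hne
  split_ifs at hne with hle
  · have := le_totalDegree hm
    rw [degree_fin_two] at this
    omega
  · simp at hne

/-- **Top-degree coefficients** of `Q(l + sX)`: for `|n| = deg Q` the coefficient is
`s^{|n|} · coeff n Q`. -/
theorem coeff_aeval_affine_top (l : Fin 2 → L) (s : L) (Q : MvPolynomial (Fin 2) L)
    (n : Fin 2 →₀ ℕ) (hn : n 0 + n 1 = Q.totalDegree) :
    coeff n (aeval (fun i => C (l i) + C s * X i) Q) = s ^ (n 0 + n 1) * coeff n Q := by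
  rw [coeff_aeval_affine, Finset.sum_eq_single n]
  · rw [coeff_linear_pow_mul, if_pos ⟨le_rfl, le_rfl⟩]
    simp only [Nat.sub_self, pow_zero, mul_one, Nat.choose_self, Nat.cast_one]
    ring
  · intro m hm hmn
    rw [coeff_linear_pow_mul, if_neg, mul_zero]
    rintro ⟨h0, h1⟩
    have := le_totalDegree hm
    rw [degree_fin_two] at this
    apply hmn
    rw [finsupp_fin_two_eq_iff]
    omega
  · intro hn'
    rw [notMem_support_iff.mp hn', zero_mul]

/-- **Next-to-top coefficients** of `Q(l + sX)`: for `|n| + 1 = deg Q` the coefficient is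
`s^{|n|} (coeff n Q + (n₀+1) coeff (n+e₀) Q · l₀ + (n₁+1) coeff (n+e₁) Q · l₁)`. -/
theorem coeff_aeval_affine_next (l : Fin 2 → L) (s : L) (Q : MvPolynomial (Fin 2) L)
    (n : Fin 2 →₀ ℕ) (hn : n 0 + n 1 + 1 = Q.totalDegree) :
    coeff n (aeval (fun i => C (l i) + C s * X i) Q) =
      s ^ (n 0 + n 1) * (coeff n Q
        + ((n 0 + 1 : ℕ) : L) * coeff (n + Finsupp.single 0 1) Q * l 0
        + ((n 1 + 1 : ℕ) : L) * coeff (n + Finsupp.single 1 1) Q * l 1) := by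
  classical
  rw [coeff_aeval_affine]
  have e0a : (n + Finsupp.single (0 : Fin 2) 1 : Fin 2 →₀ ℕ) 0 = n 0 + 1 := by simp
  have e0b : (n + Finsupp.single (0 : Fin 2) 1 : Fin 2 →₀ ℕ) 1 = n 1 := by simp
  have e1a : (n + Finsupp.single (1 : Fin 2) 1 : Fin 2 →₀ ℕ) 0 = n 0 := by simp
  have e1b : (n + Finsupp.single (1 : Fin 2) 1 : Fin 2 →₀ ℕ) 1 = n 1 + 1 := by simp
  have hpt : ∀ m ∈ Q.support, coeff m Q *
      coeff n ((C (l 0) + C s * X 0) ^ (m 0) * (C (l 1) + C s * X 1) ^ (m 1) :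
        MvPolynomial (Fin 2) L) =
      (if m = n then coeff m Q * s ^ (n 0 + n 1) else 0)
      + (if m = n + Finsupp.single 0 1 then coeff m Q * (s ^ (n 0 + n 1) * l 0 * ((n 0 + 1 : ℕ) : L))
          else 0)
      + (if m = n + Finsupp.single 1 1 then coeff m Q * (s ^ (n 0 + n 1) * l 1 * ((n 1 + 1 : ℕ) : L))
          else 0) := by
    intro m hm
    have hdeg := le_totalDegree hm
    rw [degree_fin_two] at hdeg
    rw [coeff_linear_pow_mul]
    by_cases h : n 0 ≤ m 0 ∧ n 1 ≤ m 1
    · rw [if_pos h]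
      have h3 : (m 0 = n 0 ∧ m 1 = n 1) ∨ (m 0 = n 0 + 1 ∧ m 1 = n 1) ∨
          (m 0 = n 0 ∧ m 1 = n 1 + 1) := by omega
      rcases h3 with ⟨h0, h1⟩ | ⟨h0, h1⟩ | ⟨h0, h1⟩
      · have hm1 : m = n := (finsupp_fin_two_eq_iff m n).mpr ⟨h0, h1⟩
        have hm2 : m ≠ n + Finsupp.single 0 1 := by
          rw [Ne, finsupp_fin_two_eq_iff, e0a, e0b]; omega
        have hm3 : m ≠ n + Finsupp.single 1 1 := by
          rw [Ne, finsupp_fin_two_eq_iff, e1a, e1b]; omega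
        rw [if_pos hm1, if_neg hm2, if_neg hm3, h0, h1]
        simp only [Nat.sub_self, pow_zero, Nat.choose_self, Nat.cast_one, add_zero]
        ring
      · have hm1 : m ≠ n := by
          rw [Ne, finsupp_fin_two_eq_iff]; omega
        have hm2 : m = n + Finsupp.single 0 1 := by
          rw [finsupp_fin_two_eq_iff, e0a, e0b]; omega
        have hm3 : m ≠ n + Finsupp.single 1 1 := by
          rw [Ne, finsupp_fin_two_eq_iff, e1a, e1b]; omega
        rw [if_neg hm1, if_pos hm2, if_neg hm3, h0, h1]
        simp only [Nat.sub_self, pow_zero, Nat.choose_self, Nat.cast_one, zero_add, add_zero,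
          Nat.add_sub_cancel_left, pow_one, Nat.choose_succ_self_right]
        ring
      · have hm1 : m ≠ n := by
          rw [Ne, finsupp_fin_two_eq_iff]; omega
        have hm2 : m ≠ n + Finsupp.single 0 1 := by
          rw [Ne, finsupp_fin_two_eq_iff, e0a, e0b]; omega
        have hm3 : m = n + Finsupp.single 1 1 := by
          rw [finsupp_fin_two_eq_iff, e1a, e1b]; omega
        rw [if_neg hm1, if_neg hm2, if_pos hm3, h0, h1]
        simp only [Nat.sub_self, pow_zero, Nat.choose_self, Nat.cast_one, zero_add,
          Nat.add_sub_cancel_left, pow_one, Nat.choose_succ_self_right]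
        ring
    · rw [if_neg h, mul_zero]
      have hm1 : m ≠ n := by
        intro e; apply h; rw [e]; exact ⟨le_rfl, le_rfl⟩
      have hm2 : m ≠ n + Finsupp.single 0 1 := by
        intro e; apply h; rw [e, e0a, e0b]; omega
      have hm3 : m ≠ n + Finsupp.single 1 1 := by
        intro e; apply h; rw [e, e1a, e1b]; omega
      rw [if_neg hm1, if_neg hm2, if_neg hm3, add_zero, add_zero]
  rw [Finset.sum_congr rfl hpt, Finset.sum_add_distrib, Finset.sum_add_distrib,
    Finset.sum_ite_eq', Finset.sum_ite_eq', Finset.sum_ite_eq']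
  have r1 : (if n ∈ Q.support then coeff n Q * s ^ (n 0 + n 1) else 0) =
      coeff n Q * s ^ (n 0 + n 1) := by
    split_ifs with h
    · rfl
    · rw [notMem_support_iff.mp h, zero_mul]
  have r2 : (if n + Finsupp.single 0 1 ∈ Q.support then
      coeff (n + Finsupp.single 0 1) Q * (s ^ (n 0 + n 1) * l 0 * ((n 0 + 1 : ℕ) : L)) else 0) =
      coeff (n + Finsupp.single 0 1) Q * (s ^ (n 0 + n 1) * l 0 * ((n 0 + 1 : ℕ) : L)) := by
    split_ifs with h
    · rfl
    · rw [notMem_support_iff.mp h, zero_mul]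
  have r3 : (if n + Finsupp.single 1 1 ∈ Q.support then
      coeff (n + Finsupp.single 1 1) Q * (s ^ (n 0 + n 1) * l 1 * ((n 1 + 1 : ℕ) : L)) else 0) =
      coeff (n + Finsupp.single 1 1) Q * (s ^ (n 0 + n 1) * l 1 * ((n 1 + 1 : ℕ) : L)) := by
    split_ifs with h
    · rfl
    · rw [notMem_support_iff.mp h, zero_mul]
  rw [r1, r2, r3]
  ring

end Summit.Schanuel.Schanuel.Theorems.RigidCore.TwoLogs
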